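import Summits.BirchSwinnertonDyer.BirchSwinnertonDyer.Theorems.ResidualThetaTransportAtTwoThetaLayerLambdaCongruenceAtTwoManinChain
import HarnessLib

/-!
# Crux `ThetaLayerLambdaCongruenceAtTwo` (stmt-BirchSwinnertonDyer-20688, route ResidualThetaTransportAtTwo), line
# `birth` v14 — SD floor, kernel road, Hecke clause of IP, brick HA7 «FAREY BOOKKEEPING» of
# `Cruxes/ThetaLayerLambdaCongruenceAtTwo/Lines/birth-sd2-hecke-adjoint.md` §3 (D) / §4
# (width seat bsd-wall-rtt-p3-w2 g8; `--supports stmt-BirchSwinnertonDyer-20688 --as helper`; closes nothing)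

HONEST FRAMING. Elementary THEOREMS about lists in `SL₂(ℤ)` and `2×2` integer matrices (telescoping sums); nothing about any curve
or form is asserted; BSD is not proved by any of this; Kan⁺ 20688 is not settled by this file.

WHAT. On the Farey side of the adjointness identity `B(T_α x, y) = B(x, T_α̃ y)` one needs a MANIN CHAIN (in the universal sense of
`exists_maninChain`: `Σ_{f} F(f) − F(fS) = F(δ) − F(1)` for every cusp function `F`, i.e. `F(gT) = F(g)`, `F(−g) = F(g)`) of each
matrix `δ = δ'_M` of the Hecke cocycle `M γ' = δ'_M M_σ` (`M`, `M_σ` upper-triangular integer matrices of the same positive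
determinant). It is obtained by concatenating, over the Manin chain `L` of `γ'`, re-expansions `P(g)` of the generalised edges
`M g·{∞, 0}` into Farey edges (brick HA4, lead g13). This file proves the bookkeeping:
* `apply_eq_of_col_parallel` — a cusp function takes the same value on `k, k' ∈ SL₂(ℤ)` with parallel first columns
  (`k' = ±kTⁿ`); `exists_anchor` — every non-zero integer column is parallel to the first column of some `k ∈ SL₂(ℤ)` (Bezout);
  `col_parallel_trans` — parallelism through a non-zero column.
* `sum_map_flatMap` — `Σ` over a concatenation is the `Σ` of the `Σ`'s.
* **`flatMap_reexpansion_isManinChain`** — if every `P(g)`, `g ∈ L`, has the ANCHORED RE-EXPANSION PROPERTY for `C = M g`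
  («`Σ_{f∈P} F f − F(fS) = F k₁ − F k₂` whenever `k₁∞ = C∞`, `k₂∞ = C0`», the only property of HA4 used here), then `L.flatMap P`
  is a Manin chain of `δ`: the anchors at `∞` cancel because `M∞ = ∞ = M_σ∞`.
References: [Manin1972] Thm. 1.6 (Manin's trick); [Merel1994] §1.2–1.3 (Heilbronn matrices move Farey edges to generalised edges,
re-expanded along continued fractions); [CremonaAlgorithms1997] §2.2.
-/

open scoped MatrixGroups

open Matrix.SpecialLinearGroup ModularGroup

namespace Summit.BirchSwinnertonDyer.BirchSwinnertonDyer.Theorems.ThetaLayerLambdaCongruenceAtTwo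

universe u

/-! ## §1. Cusp functions and anchors -/

section Cusp

/-- An element of `SL₂(ℤ)` with first column `(1, 0)ᵀ`… more generally with `k₁₀ = 0`, is `±Tⁿ`: if `k 1 0 = 0` then
`k = T^{k₀₁}` (when `k₀₀ = 1`) or `k = −T^{−k₀₁}` (when `k₀₀ = −1`). [folklore] -/
theorem eq_T_zpow_or_of_apply_one_zero (k : SL(2, ℤ)) (hk : k 1 0 = 0) :
    k = T ^ (k 0 1) ∨ k = -(T ^ (-(k 0 1))) := by
  have hdet : k 0 0 * k 1 1 = 1 := by
    have := Matrix.det_fin_two k.1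
    rw [k.2, hk, mul_zero, sub_zero] at this
    exact this.symm
  rcases Int.eq_one_or_neg_one_of_mul_eq_one hdet with h00 | h00
  · have h11 : k 1 1 = 1 := by rw [h00, one_mul] at hdet; exact hdet
    left; ext i j
    fin_cases i <;> fin_cases j <;> simp [coe_T_zpow, h00, h11, hk]
  · have h11 : k 1 1 = -1 := by rw [h00] at hdet; linarith
    right; ext i j
    fin_cases i <;> fin_cases j <;> simp [coe_T_zpow, h00, h11, hk]

/-- **A cusp function only sees the cusp.** If `F : SL₂(ℤ) → A` satisfies `F(gT) = F(g)` and `F(−g) = F(g)`, and `k, k' ∈ SL₂(ℤ)`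
have parallel first columns (`k₀₀ k'₁₀ = k₁₀ k'₀₀`, i.e. `k∞ = k'∞`), then `F k = F k'` (`k' = ±kTⁿ`). [cite: Manin1972, Thm. 1.6] -/
theorem apply_eq_of_col_parallel {A : Type u} (F : SL(2, ℤ) → A) (hT : ∀ g, F (g * T) = F g) (hneg : ∀ g, F (-g) = F g)
    {k k' : SL(2, ℤ)} (h : k 0 0 * k' 1 0 = k 1 0 * k' 0 0) : F k = F k' := by
  have h10 : (k⁻¹ * k') 1 0 = 0 := by
    rw [Matrix.SpecialLinearGroup.coe_mul, Matrix.SpecialLinearGroup.SL2_inv_expl]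
    simp [Matrix.mul_apply, Fin.sum_univ_two]
    linear_combination h
  have hk' : k' = k * (k⁻¹ * k') := by rw [mul_inv_cancel_left]
  rcases eq_T_zpow_or_of_apply_one_zero (k⁻¹ * k') h10 with hm | hm
  · rw [hk', hm, apply_mul_T_zpow_of_apply_mul_T F hT]
  · rw [hk', hm, mul_neg, hneg, apply_mul_T_zpow_of_apply_mul_T F hT]

/-- **Anchors exist.** Every non-zero integer column `(a, c)` is parallel to the first column of some `k ∈ SL₂(ℤ)`
(`a k₁₀ = c k₀₀`): write `(a, c) = g (a', c')` with `gcd(a', c') = 1` and complete `(a', c')` to a matrix of determinant `1`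
(Bezout). [folklore] -/
theorem exists_anchor (a c : ℤ) (h : a ≠ 0 ∨ c ≠ 0) : ∃ k : SL(2, ℤ), a * k 1 0 = c * k 0 0 := by
  have hg : 0 < Int.gcd a c := Int.gcd_pos_iff.mpr h
  obtain ⟨g, a', c', -, hcop, ha, hc⟩ := Int.exists_gcd_one' hg
  have hbez := Int.gcd_eq_gcd_ab a' c'
  rw [hcop, Nat.cast_one] at hbez
  refine ⟨⟨!![a', -Int.gcdB a' c'; c', Int.gcdA a' c'], ?_⟩, ?_⟩
  · rw [Matrix.det_fin_two_of]; linear_combination -hbez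
  · simp only [Matrix.of_apply, Matrix.cons_val', Matrix.cons_val_zero, Matrix.cons_val_one,
      Matrix.cons_val_fin_one]
    rw [ha, hc]; ring

/-- **Parallelism through a non-zero column**: if `v = (a, c) ≠ 0` is parallel to the first columns of `k` and of `k'`, then these
are parallel to each other. [folklore] -/
theorem col_parallel_trans {a c : ℤ} (h : a ≠ 0 ∨ c ≠ 0) {k k' : SL(2, ℤ)} (hk : a * k 1 0 = c * k 0 0)
    (hk' : a * k' 1 0 = c * k' 0 0) : k 0 0 * k' 1 0 = k 1 0 * k' 0 0 := by
  rcases h with ha | hc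
  · have e : a * (k 0 0 * k' 1 0 - k 1 0 * k' 0 0) = 0 := by linear_combination k 0 0 * hk' - k' 0 0 * hk
    rcases mul_eq_zero.mp e with h0 | h0
    · exact absurd h0 ha
    · linarith
  · have e : c * (k 0 0 * k' 1 0 - k 1 0 * k' 0 0) = 0 := by linear_combination k 1 0 * hk' - k' 1 0 * hk
    rcases mul_eq_zero.mp e with h0 | h0
    · exact absurd h0 hc
    · linarith

/-- The first column of an element of `SL₂(ℤ)` is non-zero. [folklore] -/
theorem col_ne_zero (g : SL(2, ℤ)) : g 0 0 ≠ 0 ∨ g 1 0 ≠ 0 := by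
  by_contra h
  simp only [not_or, not_not] at h
  have := Matrix.det_fin_two g.1
  rw [g.2, h.1, h.2] at this
  simp at this

/-- The first column of `M·g` is non-zero for an integer matrix `M` with `det M ≠ 0` and `g ∈ SL₂(ℤ)`. [folklore] -/
theorem mul_col_ne_zero (M : Matrix (Fin 2) (Fin 2) ℤ) (hM : M.det ≠ 0) (g : SL(2, ℤ)) :
    (M * (g : Matrix (Fin 2) (Fin 2) ℤ)) 0 0 ≠ 0 ∨ (M * (g : Matrix (Fin 2) (Fin 2) ℤ)) 1 0 ≠ 0 := by
  by_contra h
  simp only [not_or, not_not] at h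
  obtain ⟨h0, h1⟩ := h
  simp only [Matrix.mul_apply, Fin.sum_univ_two] at h0 h1
  have hdet : M 0 0 * M 1 1 - M 0 1 * M 1 0 ≠ 0 := by rwa [Matrix.det_fin_two] at hM
  -- `M (col₀ g) = 0` with `M` invertible over `ℚ` forces `col₀ g = 0`
  have e0 : (M 0 0 * M 1 1 - M 0 1 * M 1 0) * g 0 0 = 0 := by linear_combination M 1 1 * h0 - M 0 1 * h1
  have e1 : (M 0 0 * M 1 1 - M 0 1 * M 1 0) * g 1 0 = 0 := by linear_combination M 0 0 * h1 - M 1 0 * h0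
  rcases col_ne_zero g with hg | hg
  · exact hg ((mul_eq_zero.mp e0).resolve_left hdet)
  · exact hg ((mul_eq_zero.mp e1).resolve_left hdet)

end Cusp

/-! ## §2. Sums over concatenations -/

section Lists

/-- `Σ` over `L.flatMap P` is the sum over `g ∈ L` of the `Σ` over `P g`. [folklore] -/
theorem sum_map_flatMap {A : Type u} [AddCommMonoid A] {ι κ : Type*} (L : List ι) (P : ι → List κ) (h : κ → A) :
    ((L.flatMap P).map h).sum = (L.map fun g ↦ ((P g).map h).sum).sum := by
  induction L with
  | nil => simp
  | cons g L ih => rw [List.flatMap_cons, List.map_append, List.sum_append, ih, List.map_cons, List.sum_cons]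

end Lists

/-! ## §3. The concatenated re-expansion is a Manin chain of `δ'_M` -/

section Bookkeeping

/-- Column bookkeeping: `(gT)`'s first column is `g`'s; `(gS)`'s first column is `g`'s second; `(−g)`'s is `−` `g`'s. [folklore] -/
theorem col_mul_T_mul_S (g : SL(2, ℤ)) :
    ((g * T) 0 0 = g 0 0 ∧ (g * T) 1 0 = g 1 0) ∧ ((g * S) 0 0 = g 0 1 ∧ (g * S) 1 0 = g 1 1) ∧
      ((-g) 0 0 = -g 0 0 ∧ (-g) 1 0 = -g 1 0) := by
  refine ⟨⟨?_, ?_⟩, ⟨?_, ?_⟩, ⟨?_, ?_⟩⟩ <;>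
    simp [Matrix.SpecialLinearGroup.coe_mul, coe_T, coe_S, Matrix.mul_apply, Fin.sum_univ_two]

/-- **HA7 — Farey bookkeeping.** Let `F` be a cusp function (`F(gT) = F g`, `F(−g) = F g`), `M`, `M_σ` upper-triangular integer
matrices with non-zero determinant and `M γ' = δ M_σ` (`γ', δ ∈ SL₂(ℤ)`: the Hecke cocycle at the cusp `∞`), `L` a universal Manin
chain of `γ'` (`Σ_{g∈L} G g − G(gS) = G γ' − G 1` for every cusp function `G : SL₂(ℤ) → A`), and for each `g ∈ L` let `P g` be a
list with the ANCHORED RE-EXPANSION PROPERTY for the generalised edge of `C = M g`: `Σ_{f ∈ P g} F f − F(fS) = F k₁ − F k₂`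
whenever `k₁∞ = C∞` and `k₂∞ = C0` (`C₀₀ k₁,₁₀ = C₁₀ k₁,₀₀`, `C₀₁ k₂,₁₀ = C₁₁ k₂,₀₀`). Then the concatenation `L.flatMap P` is a
Manin chain of `δ`: `Σ_{f} F f − F(fS) = F δ − F 1`. (Telescoping with the cusp function `g ↦ F(anchor of M·g∞)`; at the ends,
`M γ'∞ = δ M_σ ∞ = δ∞` and `M∞ = ∞`.) [cite: Merel1994, §1.3] -/
theorem flatMap_reexpansion_isManinChain {A : Type u} [AddCommGroup A] (F : SL(2, ℤ) → A)
    (hT : ∀ g, F (g * T) = F g) (hneg : ∀ g, F (-g) = F g)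
    {γ' δ : SL(2, ℤ)} {M Mσ : Matrix (Fin 2) (Fin 2) ℤ} (hM : M.det ≠ 0) (hM10 : M 1 0 = 0) (hMσ10 : Mσ 1 0 = 0)
    (hMσ00 : Mσ 0 0 ≠ 0)
    (hcoc : M * (γ' : Matrix (Fin 2) (Fin 2) ℤ) = (δ : Matrix (Fin 2) (Fin 2) ℤ) * Mσ)
    (L : List SL(2, ℤ)) (P : SL(2, ℤ) → List SL(2, ℤ))
    (hL : ∀ G : SL(2, ℤ) → A, (∀ g, G (g * T) = G g) → (∀ g, G (-g) = G g) →
      (L.map fun g ↦ G g - G (g * S)).sum = G γ' - G 1)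
    (hP : ∀ g ∈ L, ∀ k₁ k₂ : SL(2, ℤ),
      (M * (g : Matrix (Fin 2) (Fin 2) ℤ)) 0 0 * k₁ 1 0 = (M * (g : Matrix (Fin 2) (Fin 2) ℤ)) 1 0 * k₁ 0 0 →
      (M * (g : Matrix (Fin 2) (Fin 2) ℤ)) 0 1 * k₂ 1 0 = (M * (g : Matrix (Fin 2) (Fin 2) ℤ)) 1 1 * k₂ 0 0 →
      ((P g).map fun f ↦ F f - F (f * S)).sum = F k₁ - F k₂) :
    ((L.flatMap P).map fun f ↦ F f - F (f * S)).sum = F δ - F 1 := by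
  -- anchors for all columns (junk where the column vanishes)
  have hex : ∀ v : ℤ × ℤ, ∃ k : SL(2, ℤ), (v.1 ≠ 0 ∨ v.2 ≠ 0) → v.1 * k 1 0 = v.2 * k 0 0 := by
    intro v
    by_cases hv : v.1 ≠ 0 ∨ v.2 ≠ 0
    · obtain ⟨k, hk⟩ := exists_anchor v.1 v.2 hv
      exact ⟨k, fun _ ↦ hk⟩
    · exact ⟨1, fun h ↦ absurd h hv⟩
  choose anc hanc using hex
  -- the auxiliary cusp function `G g = F (anchor of the column M·g∞)`
  obtain ⟨G, hG⟩ : ∃ G : SL(2, ℤ) → A, ∀ g : SL(2, ℤ),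
      G g = F (anc ((M * (g : Matrix (Fin 2) (Fin 2) ℤ)) 0 0, (M * (g : Matrix (Fin 2) (Fin 2) ℤ)) 1 0)) :=
    ⟨_, fun _ ↦ rfl⟩
  have hcol : ∀ g : SL(2, ℤ), ∀ i : Fin 2,
      (M * (g : Matrix (Fin 2) (Fin 2) ℤ)) i 0 = M i 0 * g 0 0 + M i 1 * g 1 0 := fun g i ↦ by
    simp [Matrix.mul_apply, Fin.sum_univ_two]
  have hcol1 : ∀ g : SL(2, ℤ), ∀ i : Fin 2,
      (M * (g : Matrix (Fin 2) (Fin 2) ℤ)) i 1 = M i 0 * g 0 1 + M i 1 * g 1 1 := fun g i ↦ by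
    simp [Matrix.mul_apply, Fin.sum_univ_two]
  -- `G` is a cusp function
  have hGT : ∀ g, G (g * T) = G g := fun g ↦ by
    obtain ⟨⟨h0, h1⟩, -, -⟩ := col_mul_T_mul_S g
    rw [hG, hG, hcol, hcol, hcol, hcol, h0, h1]
  have hGneg : ∀ g, G (-g) = G g := fun g ↦ by
    obtain ⟨-, -, ⟨h0, h1⟩⟩ := col_mul_T_mul_S g
    rw [hG, hG]
    have h1' := hanc ((M * (g : Matrix (Fin 2) (Fin 2) ℤ)) 0 0, (M * (g : Matrix (Fin 2) (Fin 2) ℤ)) 1 0)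
      (mul_col_ne_zero M hM g)
    have hvn := mul_col_ne_zero M hM (-g)
    have h2' := hanc ((M * ((-g : SL(2, ℤ)) : Matrix (Fin 2) (Fin 2) ℤ)) 0 0,
      (M * ((-g : SL(2, ℤ)) : Matrix (Fin 2) (Fin 2) ℤ)) 1 0) hvn
    dsimp only at h1' h2'
    set k₁ := anc ((M * ((-g : SL(2, ℤ)) : Matrix (Fin 2) (Fin 2) ℤ)) 0 0,
      (M * ((-g : SL(2, ℤ)) : Matrix (Fin 2) (Fin 2) ℤ)) 1 0) with hk₁
    set k₂ := anc ((M * (g : Matrix (Fin 2) (Fin 2) ℤ)) 0 0, (M * (g : Matrix (Fin 2) (Fin 2) ℤ)) 1 0) with hk₂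
    refine apply_eq_of_col_parallel F hT hneg (col_parallel_trans hvn h2' ?_)
    have en : ∀ i : Fin 2, (M * ((-g : SL(2, ℤ)) : Matrix (Fin 2) (Fin 2) ℤ)) i 0 =
        -((M * (g : Matrix (Fin 2) (Fin 2) ℤ)) i 0) := fun i ↦ by
      rw [hcol, hcol, h0, h1]; ring
    rw [en 0, en 1]
    linear_combination -h1'
  -- each block telescopes between `G g` and `G (gS)`
  have hblock : ∀ g ∈ L, ((P g).map fun f ↦ F f - F (f * S)).sum = G g - G (g * S) := by
    intro g hg
    rw [hG, hG]
    have h1' := hanc ((M * (g : Matrix (Fin 2) (Fin 2) ℤ)) 0 0, (M * (g : Matrix (Fin 2) (Fin 2) ℤ)) 1 0)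
      (mul_col_ne_zero M hM g)
    have h2 := hanc ((M * ((g * S : SL(2, ℤ)) : Matrix (Fin 2) (Fin 2) ℤ)) 0 0,
      (M * ((g * S : SL(2, ℤ)) : Matrix (Fin 2) (Fin 2) ℤ)) 1 0) (mul_col_ne_zero M hM (g * S))
    dsimp only at h1' h2
    set k₁ := anc ((M * (g : Matrix (Fin 2) (Fin 2) ℤ)) 0 0, (M * (g : Matrix (Fin 2) (Fin 2) ℤ)) 1 0) with hk₁
    set k₂ := anc ((M * ((g * S : SL(2, ℤ)) : Matrix (Fin 2) (Fin 2) ℤ)) 0 0,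
      (M * ((g * S : SL(2, ℤ)) : Matrix (Fin 2) (Fin 2) ℤ)) 1 0) with hk₂
    refine hP g hg k₁ k₂ h1' ?_
    obtain ⟨-, ⟨h0, h1⟩, -⟩ := col_mul_T_mul_S g
    have es : ∀ i : Fin 2, (M * ((g * S : SL(2, ℤ)) : Matrix (Fin 2) (Fin 2) ℤ)) i 0 =
        (M * (g : Matrix (Fin 2) (Fin 2) ℤ)) i 1 := fun i ↦ by
      rw [hcol, hcol1, h0, h1]
    rw [← es 0, ← es 1]
    exact h2
  -- sum of the blocks
  rw [sum_map_flatMap]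
  have hLG := hL G hGT hGneg
  rw [show (L.map fun g ↦ ((P g).map fun f ↦ F f - F (f * S)).sum) = L.map fun g ↦ G g - G (g * S) from
    List.map_congr_left hblock, hLG, hG, hG]
  -- the two anchors at the ends: `M γ'∞ = δ∞` and `M∞ = ∞`
  congr 1
  · have h2 := hanc ((M * (γ' : Matrix (Fin 2) (Fin 2) ℤ)) 0 0, (M * (γ' : Matrix (Fin 2) (Fin 2) ℤ)) 1 0)
      (mul_col_ne_zero M hM γ')
    dsimp only at h2
    set k := anc ((M * (γ' : Matrix (Fin 2) (Fin 2) ℤ)) 0 0, (M * (γ' : Matrix (Fin 2) (Fin 2) ℤ)) 1 0) with hk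
    refine apply_eq_of_col_parallel F hT hneg ?_
    -- `(M γ') i 0 = (δ Mσ) i 0 = Mσ₀₀ δ i 0`
    have e : ∀ i : Fin 2, (M * (γ' : Matrix (Fin 2) (Fin 2) ℤ)) i 0 = Mσ 0 0 * δ i 0 := fun i ↦ by
      rw [hcoc]; simp [Matrix.mul_apply, Fin.sum_univ_two, hMσ10]; ring
    have e2 : Mσ 0 0 * (k 0 0 * δ 1 0 - k 1 0 * δ 0 0) = 0 := by
      linear_combination -h2 - k 0 0 * e 1 + k 1 0 * e 0
    rcases mul_eq_zero.mp e2 with h0 | h0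
    · exact absurd h0 hMσ00
    · linear_combination h0
  · have h2 := hanc ((M * ((1 : SL(2, ℤ)) : Matrix (Fin 2) (Fin 2) ℤ)) 0 0,
      (M * ((1 : SL(2, ℤ)) : Matrix (Fin 2) (Fin 2) ℤ)) 1 0) (mul_col_ne_zero M hM 1)
    dsimp only at h2
    set k := anc ((M * ((1 : SL(2, ℤ)) : Matrix (Fin 2) (Fin 2) ℤ)) 0 0,
      (M * ((1 : SL(2, ℤ)) : Matrix (Fin 2) (Fin 2) ℤ)) 1 0) with hk
    refine apply_eq_of_col_parallel F hT hneg ?_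
    have e0 : (M * ((1 : SL(2, ℤ)) : Matrix (Fin 2) (Fin 2) ℤ)) 0 0 = M 0 0 := by simp
    have e1 : (M * ((1 : SL(2, ℤ)) : Matrix (Fin 2) (Fin 2) ℤ)) 1 0 = 0 := by simp [hM10]
    rw [e0, e1, zero_mul] at h2
    have hM00 : M 0 0 ≠ 0 := by
      intro h0; apply hM; rw [Matrix.det_fin_two, h0, hM10]; ring
    have hk0 : k 1 0 = 0 := (mul_eq_zero.mp h2).resolve_left hM00
    rw [hk0, zero_mul]
    simp

end Bookkeeping

/-! ## §4. The same with the anchors DELIVERED by the re-expansion (shape of `exists_reexpansion`, brick HA4) -/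

section Adapter

/-- **HA7 in the output shape of HA4.** Same as `flatMap_reexpansion_isManinChain`, but each block `P g` is given with ITS OWN
anchors, exactly as brick HA4 (`…HeckeAdjointReexpansion.exists_reexpansion`, w3 g11) delivers them for `C = M·g`: matrices
`g₀, g₀h₁ ∈ SL₂(ℤ)` and integers `u, d ≠ 0` with `C i 0 = u·g₀ i 0`, `C i 1 = d·(g₀h₁) i 0`, and the telescoping
`Σ_{f ∈ P g} F(fS) − F f = F(g₀h₁) − F g₀` (note HA4's orientation `F(fS) − F f`). Conclusion: `L.flatMap P` is a Manin chain of `δ`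
in the orientation of `exists_maninChain` / `hB`: `Σ_f F f − F(fS) = F δ − F 1`. (Any two anchors of the same cusp give the same value
of a cusp function: `apply_eq_of_col_parallel`.) [cite: Merel1994, §1.3] -/
theorem flatMap_reexpansion_isManinChain_of_anchors {A : Type u} [AddCommGroup A] (F : SL(2, ℤ) → A)
    (hT : ∀ g, F (g * T) = F g) (hneg : ∀ g, F (-g) = F g)
    {γ' δ : SL(2, ℤ)} {M Mσ : Matrix (Fin 2) (Fin 2) ℤ} (hM : M.det ≠ 0) (hM10 : M 1 0 = 0) (hMσ10 : Mσ 1 0 = 0)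
    (hMσ00 : Mσ 0 0 ≠ 0)
    (hcoc : M * (γ' : Matrix (Fin 2) (Fin 2) ℤ) = (δ : Matrix (Fin 2) (Fin 2) ℤ) * Mσ)
    (L : List SL(2, ℤ)) (P : SL(2, ℤ) → List SL(2, ℤ))
    (hL : ∀ G : SL(2, ℤ) → A, (∀ g, G (g * T) = G g) → (∀ g, G (-g) = G g) →
      (L.map fun g ↦ G g - G (g * S)).sum = G γ' - G 1)
    (hP : ∀ g ∈ L, ∃ (g₀ h₁ : SL(2, ℤ)) (u d : ℤ), u ≠ 0 ∧ d ≠ 0 ∧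
      (∀ i, (M * (g : Matrix (Fin 2) (Fin 2) ℤ)) i 0 = u * g₀ i 0) ∧
      (∀ i, (M * (g : Matrix (Fin 2) (Fin 2) ℤ)) i 1 = d * (g₀ * h₁) i 0) ∧
      ((P g).map fun f ↦ F (f * S) - F f).sum = F (g₀ * h₁) - F g₀) :
    ((L.flatMap P).map fun f ↦ F f - F (f * S)).sum = F δ - F 1 := by
  refine flatMap_reexpansion_isManinChain F hT hneg hM hM10 hMσ10 hMσ00 hcoc L P hL ?_
  intro g hg k₁ k₂ hk₁ hk₂
  obtain ⟨g₀, h₁, u, d, hu, hd, hc0, hc1, htel⟩ := hP g hg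
  -- `k₁ ∥ g₀` and `k₂ ∥ g₀h₁`
  have e1 : F k₁ = F g₀ := by
    refine (apply_eq_of_col_parallel F hT hneg ?_).symm
    rw [hc0, hc0] at hk₁
    have e : u * (g₀ 0 0 * k₁ 1 0 - g₀ 1 0 * k₁ 0 0) = 0 := by linear_combination hk₁
    rcases mul_eq_zero.mp e with h0 | h0
    · exact absurd h0 hu
    · linear_combination h0
  have e2 : F k₂ = F (g₀ * h₁) := by
    refine (apply_eq_of_col_parallel F hT hneg ?_).symm
    rw [hc1, hc1] at hk₂
    have e : d * ((g₀ * h₁) 0 0 * k₂ 1 0 - (g₀ * h₁) 1 0 * k₂ 0 0) = 0 := by linear_combination hk₂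
    rcases mul_eq_zero.mp e with h0 | h0
    · exact absurd h0 hd
    · linear_combination h0
  -- flip the orientation of the telescoping sum
  have hflip : ∀ Q : List SL(2, ℤ),
      (Q.map fun f ↦ F f - F (f * S)).sum = -(Q.map fun f ↦ F (f * S) - F f).sum := by
    intro Q
    induction Q with
    | nil => simp
    | cons a Q ih => rw [List.map_cons, List.map_cons, List.sum_cons, List.sum_cons, ih]; abel
  rw [hflip, htel, e1, e2]
  abel

end Adapter

end Summit.BirchSwinnertonDyer.BirchSwinnertonDyer.Theorems.ThetaLayerLambdaCongruenceAtTwo
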